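import Mathlib
import Summits.Ventures.HodgeRepro.Tier4.Line1.RTFSetting
import Summits.Ventures.HodgeRepro.Tier4.Line1.RtfUnfold
import Summits.Ventures.HodgeRepro.Tier4.Line1.RtfSpectralStep
import Summits.Ventures.HodgeRepro.Tier4.Line1.KernelSupportFinite
import Summits.Ventures.HodgeRepro.Tier4.Line1.KernelUnfold
import Summits.Ventures.HodgeRepro.Tier4.Line1.KernelOperator
import Summits.Ventures.HodgeRepro.Tier4.Line1.KernelOpEqR
import Summits.Ventures.HodgeRepro.Tier4.Line1.KernelEigen
import Summits.Ventures.HodgeRepro.Tier4.Line1.KernelCompact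
import Summits.Ventures.HodgeRepro.Tier4.Line1.InnerCalculus
import Summits.Ventures.HodgeRepro.Tier4.Line1.KernelAdjoint
import Summits.Ventures.HodgeRepro.Tier4.Line1.RelClosed
import Summits.Ventures.HodgeRepro.Tier4.Line1.RelClosedOrtho
import Summits.Ventures.HodgeRepro.Tier4.Line1.IrreducibleMinimal
import Summits.Ventures.HodgeRepro.Tier4.Line1.IrreducibleSubspace

/-!
# Tier4/Line4/IrreducibleSubspaceClosed — J1-(4b) with the CLOSEDNESS of the irreducible subspace exported

Blind re-derivation cell `pub-hodge-repro`, Tier 4 «prove the step» (README §9–§10), seat t4-L4-p1 (prover, LINE L4,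
gen 3; candidate finding F-L4-DENSE S13894).  Tree path `lean/Summits/Ventures/HodgeRepro/Tier4/Line4/IrreducibleSubspaceClosed.lean`.

WHAT IS PROVED.  `exists_irreducible_invariant_subspace_closed_of_nondegenerate`: t4-L1-p4's
`Line1/IrreducibleSubspace.exists_irreducible_invariant_subspace_of_nondegenerate` (J1-(4b) modulo (4a)) with ONE more
conjunct in the conclusion — the irreducible subspace `V′` is RELATIVELY CLOSED: every continuous `G(k)`-invariant
function that is an `L²(D_G)`-limit of members of `V′` is a member.  The proof is L1-p4's verbatim (credited; the
subspace it builds, `U* =` the intersection of all relatively closed invariant subspaces with the minimal eigen-trace, is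
`RelClosed` by construction — `hUstarRC.closed` is the exported field).  Why: an adapted ONB whose constituents are
closed asks the L4 wall's per-constituent clauses of GENUINE constituents only (a closed dense subspace of a closed
constituent is the constituent), never of a dense non-closed invariant subspace without `(τ′,K)`-vectors
(F-L4-DENSE).

HC_CM is NOT proved by anyone in this repository.
-/

set_option autoImplicit false

noncomputable section

namespace Summit.Ventures.HodgeRepro.Tier4.Line4

open Summit.Ventures.HodgeRepro.Tier4.Line1 MeasureTheory Topology Filter Set
open scoped Uniformity Pointwise InnerProductSpace ComplexConjugate

open RTF

section Closed

variable {G : Type} [Group G] [TopologicalSpace G] [IsTopologicalGroup G] [MeasurableSpace G]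
  [BorelSpace G] (S : RTF.Setting G)

/-- **J1-(4b) modulo (4a), closedness exported**: every relatively closed invariant `V` with a non-zero member
contains a non-zero irreducible invariant subspace that is itself relatively closed (L1-p4's construction; the
last conjunct is new). -/
theorem exists_irreducible_invariant_subspace_closed_of_nondegenerate [SecondCountableTopology G]
    (V : Set (G → ℂ)) (hV : S.IsInvariantSubspace V)
    (hclosed : ∀ ψ : G → ℂ, Continuous ψ → S.Invariant ψ →
      (∀ ε : ℝ, 0 < ε → ∃ ψ' ∈ V,
        eLpNorm (fun x => ψ x - ψ' x) 2 (S.μ.restrict S.DG) < ENNReal.ofReal ε) → ψ ∈ V)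
    (hne : ∃ ψ ∈ V, ∃ x, ψ x ≠ 0)
    (h4a : ∀ ψ : Lp ℂ 2 (S.μ.restrict S.DG), ψ ≠ 0 →
      ∃ f : G → ℂ, IsTest f ∧ ¬ (S.kernelOp f ψ =ᵐ[S.μ.restrict S.DG] 0)) :
    ∃ V' : Set (G → ℂ), S.IsInvariantSubspace V' ∧ V' ⊆ V ∧ S.IsIrreducible V' ∧
      (∃ ψ ∈ V', ∃ x, ψ x ≠ 0) ∧
      ∀ ψ : G → ℂ, Continuous ψ → S.Invariant ψ →
        (∀ ε : ℝ, 0 < ε → ∃ ψ' ∈ V',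
          eLpNorm (fun x => ψ x - ψ' x) 2 (S.μ.restrict S.DG) < ENNReal.ofReal ε) → ψ ∈ V' := by
  haveI := S.haar
  haveI : Countable S.Gk := S.countable_Gk
  -- R-D: the eigenfunction
  obtain ⟨f, hf, μ, hμ, ψe, hψeV, hψex, heig⟩ := S.exists_eigen_mem V hV hclosed hne h4a
  obtain ⟨T₂, hT₂⟩ := S.exists_kernelCLM hf
  obtain ⟨T₁, hT₁⟩ := S.exists_kernelCLM hf.refl.cj
  set T := T₁.comp T₂ with hTdef
  set EH := Module.End.eigenspace (T : Lp ℂ 2 (S.μ.restrict S.DG) →ₗ[ℂ] Lp ℂ 2 (S.μ.restrict S.DG)) μ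
    with hEH
  have hTc : IsCompactOperator T := S.kernelCLM_comp_isCompactOperator hf T₁ T₂ hT₂
  haveI hEHfin : FiniteDimensional ℂ EH := ContinuousLinearMap.finite_dimensional_eigenspace hTc μ hμ
  have hfin : ∀ (U' : Set (G → ℂ)) (hU' : S.RelClosed V U'),
      FiniteDimensional ℂ ((EH ⊓ S.cls hU' : Submodule ℂ (Lp ℂ 2 (S.μ.restrict S.DG)))) :=
    fun U' hU' => Submodule.finiteDimensional_of_le inf_le_left
  -- `V` has non-zero trace
  have hV0 : S.RelClosed V V := S.relClosed_self hV hclosed ⟨ψe, hψeV⟩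
  have hψec := hV.cont ψe hψeV
  have hψeinv := hV.inv ψe hψeV
  have hue : (S.memLp_two_DG hψec).toLp ψe ∈ EH ⊓ S.cls hV0 :=
    ⟨S.toLp_mem_eigenspace hf T₁ T₂ hT₁ hT₂ hψeinv hψec heig, S.toLp_mem_cls hV0 hψeV⟩
  have hue0 : (S.memLp_two_DG hψec).toLp ψe ≠ 0 := by
    intro h0
    have h1 : ψe =ᵐ[S.μ.restrict S.DG] (0 : G → ℂ) :=
      (MemLp.coeFn_toLp (S.memLp_two_DG hψec)).symm.trans (Lp.eq_zero_iff_ae_eq_zero.mp h0)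
    have := S.eq_of_ae_eq_DG hψeinv hψec (fun _ _ => rfl) continuous_const h1
    obtain ⟨x, hx⟩ := hψex
    exact hx (by rw [this]; rfl)
  have hVne : EH ⊓ S.cls hV0 ≠ ⊥ := (Submodule.ne_bot_iff _).mpr ⟨_, hue, hue0⟩
  -- the minimal dimension
  set P : ℕ → Prop := fun n => ∃ (U : Set (G → ℂ)) (hU : S.RelClosed V U), EH ⊓ S.cls hU ≠ ⊥ ∧
    Module.finrank ℂ ((EH ⊓ S.cls hU : Submodule ℂ (Lp ℂ 2 (S.μ.restrict S.DG)))) = n with hP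
  have hPex : ∃ n, P n := ⟨_, V, hV0, hVne, rfl⟩
  classical
  obtain ⟨Umin, hUmin, hUminne, hUmindim⟩ := Nat.find_spec hPex
  set n₀ := Nat.find hPex with hn₀
  have hmin : ∀ (U' : Set (G → ℂ)) (hU' : S.RelClosed V U'), EH ⊓ S.cls hU' ≠ ⊥ →
      n₀ ≤ Module.finrank ℂ ((EH ⊓ S.cls hU' : Submodule ℂ (Lp ℂ 2 (S.μ.restrict S.DG)))) :=
    fun U' hU' hne' => Nat.find_min' hPex ⟨U', hU', hne', rfl⟩
  -- `U*`
  set Ustar : Set (G → ℂ) := {ψ | ∀ (U' : Set (G → ℂ)) (hU' : S.RelClosed V U'),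
    EH ⊓ S.cls hU' = EH ⊓ S.cls hUmin → ψ ∈ U'} with hUstar
  have hUstar_sub : Ustar ⊆ Umin := fun ψ hψ => hψ Umin hUmin rfl
  have hUstarRC : S.RelClosed V Ustar := by
    refine ⟨hUstar_sub.trans hUmin.subset, ?_, fun U' hU' _ => hU'.zero_mem, ?_⟩
    · refine ⟨fun ψ hψ => hUmin.inv.inv ψ (hUstar_sub hψ), fun ψ hψ => hUmin.inv.cont ψ (hUstar_sub hψ),
        ?_, ?_, ?_, ?_⟩
      · intro ψ hψ g U' hU' htr
        exact hU'.inv.right ψ (hψ U' hU' htr) g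
      · intro ψ hψ φ hφ U' hU' htr
        exact hU'.inv.add ψ (hψ U' hU' htr) φ (hφ U' hU' htr)
      · intro ψ hψ c U' hU' htr
        exact hU'.inv.smul ψ (hψ U' hU' htr) c
      · intro ψ hψ g hg U' hU' htr
        exact hU'.inv.conv ψ (hψ U' hU' htr) g hg
    · intro ψ hψc hψinv happ U' hU' htr
      refine hU'.closed ψ hψc hψinv fun ε hε => ?_
      obtain ⟨ψ', hψ', hlt⟩ := happ ε hε
      exact ⟨ψ', hψ' U' hU' htr, hlt⟩
  -- the trace of `U*` is the trace of `U_min`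
  have htrace : EH ⊓ S.cls hUstarRC = EH ⊓ S.cls hUmin := by
    apply le_antisymm
    · exact inf_le_inf_left _ (S.cls_mono hUstarRC hUmin hUstar_sub)
    · rintro u ⟨huE, ψ, hψUmin, huψ⟩
      refine ⟨huE, ψ, ?_, huψ⟩
      intro U' hU' htr
      have hu' : u ∈ EH ⊓ S.cls hU' := by rw [htr]; exact ⟨huE, ψ, hψUmin, huψ⟩
      obtain ⟨ψ', hψ'U', huψ'⟩ := hu'.2
      have e : ψ = ψ' := S.eq_of_ae_eq_DG (hUmin.inv.inv ψ hψUmin) (hUmin.inv.cont ψ hψUmin)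
        (hU'.inv.inv ψ' hψ'U') (hU'.inv.cont ψ' hψ'U') (huψ.symm.trans huψ')
      rw [e]
      exact hψ'U'
  have hstarne : EH ⊓ S.cls hUstarRC ≠ ⊥ := by rw [htrace]; exact hUminne
  have hstardim : Module.finrank ℂ ((EH ⊓ S.cls hUstarRC : Submodule ℂ (Lp ℂ 2 (S.μ.restrict S.DG)))) =
      n₀ := by rw [htrace, hUmindim]
  -- R-E
  have hirr : S.IsIrreducible Ustar := by
    refine S.irreducible_of_minimal hf hμ T₁ T₂ hT₁ hT₂ hUstarRC hstarne ?_ ?_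
    · intro U' hU' hne'
      rw [hstardim]
      exact hmin U' hU' hne'
    · intro U' hU' htr ψ hψ
      exact hψ U' hU' (htr.trans htrace)
  -- the non-zero member
  obtain ⟨u, ⟨-, ψ, hψstar, huψ⟩, hu0⟩ := (Submodule.ne_bot_iff _).mp hstarne
  refine ⟨Ustar, hUstarRC.inv, hUstarRC.subset, hirr, ⟨ψ, hψstar, ?_⟩, hUstarRC.closed⟩
  by_contra hall
  push Not at hall
  apply hu0
  rw [Lp.eq_zero_iff_ae_eq_zero]
  filter_upwards [huψ] with x hx
  rw [hx, hall x]
  rfl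


end Closed

end Summit.Ventures.HodgeRepro.Tier4.Line4

end
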